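/-
Copyright (c) 2026. All rights reserved.
Released under Apache 2.0 license as described in the file LICENSE.
-/
import Summits.AtomisticToContinuum.Crystallization.Theorems.ChartedZeroExcessLayeredLatticeLiouvilleVQ

/-!
# ChartedZeroExcessLayeredLatticeLiouville — part VR «FluxDecay»: the `ϱ`-UNIFORM polynomial decay of the chain blocks and of the flux blocks
  (decomp-a2c-lens-2, g58; helper of stmt-AtomisticToContinuum-26636, leaf (LD′) `ModalLipschitzZ`; brick (3) MODE EXTRACTION, critic rows
  938 (a) / 941 (e))

The crude bounds of VP (`norm_chainKL_le`, `norm_fluxBlock_le`) grow with the truncation radius `ϱ`; the window machinery of VM/VN needs bounds that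
do NOT (the modulus of the brief is chosen before `ϱ`).  Here they are, from UY's universal bond bound `‖K_{XY}‖ ≤ F(c)·N(Y − X)⁻⁸`
(`norm_layeredKernel_le`, `F = kernelConst`, `N = idxNorm`), with absolute constants:
* `norm_chainKL_le_decay`:  `‖chainKL α β‖ ≤ 49·F(c)·|β − α|⁻⁶` for `α ≠ β` — the layer-`β` section of the near set is a planar family, and
  `N((x, y, s))⁻⁸ ≤ max(|x|, s)⁻⁴ · max(|y|, s)⁻⁴` splits the planar sum into two one-dimensional tails `Σ_x max(|x|, s)⁻⁴ ≤ 7 s⁻³`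
  (`sum_inv_max_pow_four_le`, from Mathlib's `sum_Ioo_inv_sq_le`);
* `norm_fluxBlock_le_decay`:  `‖fluxBlock m k‖ ≤ 196·F(c)·(1 + |m − k|)⁻⁴` — two more one-dimensional tails over the block box
  `α ≤ min m k < max m k + 1 ≤ β` (`sum_sum_inv_pow_six_le`).
No hypothesis on `ϱ` (not even `0 ≤ ϱ`): truncation only removes bonds.
-/

namespace Summit.AtomisticToContinuum.Crystallization.Theorems.ChartedZeroExcessLayeredLatticeLiouville

open Summit.AtomisticToContinuum.Crystallization.Theorems.ChartedPlanarOrderRigidityDoor (E3)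
open Finset
open scoped InnerProductSpace RealInnerProductSpace BigOperators

noncomputable section FluxDecay

variable {c : ℝ} {a b : E3} {w : ℤ → E3}

/-! ### VR.1  One-dimensional tails -/

/-- comparison of sums along a map injective on the source, for a nonnegative target summand. [formal bookkeeping] -/
theorem sum_le_sum_of_injOn' {ι κ : Type*} [DecidableEq κ] {s : Finset ι} {t : Finset κ} {f : ι → ℝ} {g : κ → ℝ} (e : ι → κ)
    (he : Set.InjOn e s) (hst : ∀ i ∈ s, e i ∈ t) (hg : ∀ j ∈ t, 0 ≤ g j) (hfg : ∀ i ∈ s, f i ≤ g (e i)) :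
    ∑ i ∈ s, f i ≤ ∑ j ∈ t, g j :=
  calc ∑ i ∈ s, f i ≤ ∑ i ∈ s, g (e i) := sum_le_sum hfg
    _ = ∑ j ∈ s.image e, g j := (sum_image he).symm
    _ ≤ ∑ j ∈ t, g j := sum_le_sum_of_subset_of_nonneg (image_subset_iff.mpr hst) fun j hj _ => hg j hj

/-- the inverse-square tail along an injective integer labelling by naturals `> n`: `Σ_{x ∈ A} (e x)⁻² ≤ 2/(n+1)` (Mathlib `sum_Ioo_inv_sq_le`).
[formal bookkeeping] -/
theorem sum_inv_sq_le_of_injOn {A : Finset ℤ} (e : ℤ → ℕ) {n : ℕ} (he : Set.InjOn e A) (hn : ∀ x ∈ A, n < e x) :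
    ∑ x ∈ A, (((e x : ℝ)) ^ 2)⁻¹ ≤ 2 / ((n : ℝ) + 1) := by
  calc ∑ x ∈ A, (((e x : ℝ)) ^ 2)⁻¹ ≤ ∑ i ∈ Ioo n (A.sup e + 1), (((i : ℝ)) ^ 2)⁻¹ :=
        sum_le_sum_of_injOn' e he (fun x hx => mem_Ioo.mpr ⟨hn x hx, Nat.lt_succ_of_le (le_sup (f := e) hx)⟩) (fun j _ => by positivity)
          fun x _ => le_rfl
    _ ≤ 2 / ((n : ℝ) + 1) := sum_Ioo_inv_sq_le n (A.sup e + 1)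

/-- ★ the ONE-DIMENSIONAL TAIL: `Σ_{x ∈ P} max(|x|, s)⁻⁴ ≤ 7·s⁻³` for every finite `P ⊆ ℤ` and `s ≥ 1` (`2s+1` central terms `s⁻⁴`; the two tails
`Σ_{k>s} k⁻⁴ ≤ s⁻²·Σ_{k>s} k⁻² ≤ 2 s⁻³` each). [this file, g58] -/
theorem sum_inv_max_pow_four_le (P : Finset ℤ) {s : ℕ} (hs : 1 ≤ s) :
    ∑ x ∈ P, ((max ((x.natAbs : ℕ) : ℝ) ((s : ℕ) : ℝ))⁻¹) ^ 4 ≤ 7 * (((s : ℕ) : ℝ)⁻¹) ^ 3 := by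
  have hs0 : (0 : ℝ) < s := by exact_mod_cast hs
  have hs1 : (1 : ℝ) ≤ s := by exact_mod_cast hs
  rw [← sum_filter_add_sum_filter_not P (fun x : ℤ => x.natAbs ≤ s)]
  have h1 : ∑ x ∈ P with x.natAbs ≤ s, ((max ((x.natAbs : ℕ) : ℝ) ((s : ℕ) : ℝ))⁻¹) ^ 4 ≤ 3 * (((s : ℕ) : ℝ)⁻¹) ^ 3 := by
    have hterm : ∀ x ∈ P.filter (fun x : ℤ => x.natAbs ≤ s), ((max ((x.natAbs : ℕ) : ℝ) ((s : ℕ) : ℝ))⁻¹) ^ 4 = (((s : ℕ) : ℝ)⁻¹) ^ 4 := by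
      intro x hx
      rw [max_eq_right (by exact_mod_cast (mem_filter.mp hx).2)]
    rw [sum_congr rfl hterm, sum_const, nsmul_eq_mul]
    have hcard : (((P.filter (fun x : ℤ => x.natAbs ≤ s)).card : ℕ) : ℝ) ≤ 2 * s + 1 := by
      have hsub : P.filter (fun x : ℤ => x.natAbs ≤ s) ⊆ Icc (-(s : ℤ)) s := by
        intro x hx
        have := (mem_filter.mp hx).2
        rw [mem_Icc]; omega
      have h := card_le_card hsub
      rw [Int.card_Icc] at h
      have h' : ((s : ℤ) + 1 - -(s : ℤ)).toNat = 2 * s + 1 := by omega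
      rw [h'] at h
      exact_mod_cast h
    have h4 : (((s : ℕ) : ℝ)⁻¹) ^ 4 = ((s : ℕ) : ℝ)⁻¹ * (((s : ℕ) : ℝ)⁻¹) ^ 3 := pow_succ' _ 3
    calc (((P.filter (fun x : ℤ => x.natAbs ≤ s)).card : ℕ) : ℝ) * (((s : ℕ) : ℝ)⁻¹) ^ 4 ≤ (2 * s + 1) * (((s : ℕ) : ℝ)⁻¹) ^ 4 := by gcongr
      _ ≤ (3 * s) * (((s : ℕ) : ℝ)⁻¹) ^ 4 := by gcongr; linarith
      _ = 3 * (((s : ℕ) : ℝ)⁻¹) ^ 3 := by rw [h4, ← mul_assoc, mul_assoc 3, mul_inv_cancel₀ hs0.ne', mul_one]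
  have h2 : ∑ x ∈ P with ¬ x.natAbs ≤ s, ((max ((x.natAbs : ℕ) : ℝ) ((s : ℕ) : ℝ))⁻¹) ^ 4 ≤ 4 * (((s : ℕ) : ℝ)⁻¹) ^ 3 := by
    have hmem : ∀ x ∈ P.filter (fun x : ℤ => ¬ x.natAbs ≤ s), s < x.natAbs := fun x hx => not_le.mp (mem_filter.mp hx).2
    have hterm : ∀ x ∈ P.filter (fun x : ℤ => ¬ x.natAbs ≤ s),
        ((max ((x.natAbs : ℕ) : ℝ) ((s : ℕ) : ℝ))⁻¹) ^ 4 ≤ (((s : ℕ) : ℝ)⁻¹) ^ 2 * (((x.natAbs : ℕ) : ℝ) ^ 2)⁻¹ := by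
      intro x hx
      have hxs : ((s : ℕ) : ℝ) ≤ ((x.natAbs : ℕ) : ℝ) := by exact_mod_cast (hmem x hx).le
      rw [max_eq_left hxs, ← inv_pow]
      calc (((x.natAbs : ℕ) : ℝ)⁻¹) ^ 4 = (((x.natAbs : ℕ) : ℝ)⁻¹) ^ 2 * (((x.natAbs : ℕ) : ℝ)⁻¹) ^ 2 := by ring
        _ ≤ (((s : ℕ) : ℝ)⁻¹) ^ 2 * (((x.natAbs : ℕ) : ℝ)⁻¹) ^ 2 := by gcongr
    have hpos : ∑ x ∈ (P.filter fun x : ℤ => ¬ x.natAbs ≤ s) with 0 < x, (((x.natAbs : ℕ) : ℝ) ^ 2)⁻¹ ≤ 2 / ((s : ℝ) + 1) := by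
      refine sum_inv_sq_le_of_injOn Int.natAbs ?_ fun x hx => hmem x (mem_filter.mp hx).1
      intro x hx y hy hxy
      have hx' := (mem_filter.mp (mem_coe.mp hx)).2
      have hy' := (mem_filter.mp (mem_coe.mp hy)).2
      have h' : x.natAbs = y.natAbs := hxy
      omega
    have hneg : ∑ x ∈ (P.filter fun x : ℤ => ¬ x.natAbs ≤ s) with ¬ 0 < x, (((x.natAbs : ℕ) : ℝ) ^ 2)⁻¹ ≤ 2 / ((s : ℝ) + 1) := by
      refine sum_inv_sq_le_of_injOn Int.natAbs ?_ fun x hx => hmem x (mem_filter.mp hx).1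
      intro x hx y hy hxy
      have hx' := (mem_filter.mp (mem_coe.mp hx)).2
      have hy' := (mem_filter.mp (mem_coe.mp hy)).2
      have h' : x.natAbs = y.natAbs := hxy
      omega
    have htail : ∑ x ∈ P with ¬ x.natAbs ≤ s, (((x.natAbs : ℕ) : ℝ) ^ 2)⁻¹ ≤ 4 * ((s : ℕ) : ℝ)⁻¹ := by
      rw [← sum_filter_add_sum_filter_not (P.filter fun x : ℤ => ¬ x.natAbs ≤ s) (fun x : ℤ => 0 < x)]
      have h41 : 2 / ((s : ℝ) + 1) ≤ 2 * ((s : ℕ) : ℝ)⁻¹ := by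
        rw [← div_eq_mul_inv]
        exact div_le_div_of_nonneg_left (by norm_num) hs0 (by linarith)
      linarith
    calc ∑ x ∈ P with ¬ x.natAbs ≤ s, ((max ((x.natAbs : ℕ) : ℝ) ((s : ℕ) : ℝ))⁻¹) ^ 4
        ≤ ∑ x ∈ P with ¬ x.natAbs ≤ s, (((s : ℕ) : ℝ)⁻¹) ^ 2 * (((x.natAbs : ℕ) : ℝ) ^ 2)⁻¹ := sum_le_sum hterm
      _ = (((s : ℕ) : ℝ)⁻¹) ^ 2 * ∑ x ∈ P with ¬ x.natAbs ≤ s, (((x.natAbs : ℕ) : ℝ) ^ 2)⁻¹ := by rw [mul_sum]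
      _ ≤ (((s : ℕ) : ℝ)⁻¹) ^ 2 * (4 * ((s : ℕ) : ℝ)⁻¹) := by gcongr
      _ = 4 * (((s : ℕ) : ℝ)⁻¹) ^ 3 := by ring
  linarith

/-! ### VR.2  The planar sum over a layer section -/

/-- pointwise: for a site `Y` in layer `β ≠ α`, `N(Y − (0, α))⁻⁸ ≤ max(|Y₀|, s)⁻⁴ · max(|Y₁|, s)⁻⁴` with `s = |β − α|` (the index sup-norm dominates
each planar coordinate and the layer offset). [formal bookkeeping] -/
theorem inv_idxNorm_pow_eight_le (α β : ℤ) (hαβ : α ≠ β) (Y : Cell 2 × ℤ) (hY : Y.2 = β) :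
    ((((idxNorm (Y - ((0 : Cell 2), α)) : ℕ) : ℝ))⁻¹) ^ 8 ≤
      ((max (((Y.1 0).natAbs : ℕ) : ℝ) ((((β - α).natAbs : ℕ)) : ℝ))⁻¹) ^ 4 *
        ((max (((Y.1 1).natAbs : ℕ) : ℝ) ((((β - α).natAbs : ℕ)) : ℝ))⁻¹) ^ 4 := by
  have hs : 1 ≤ (β - α).natAbs := Int.natAbs_pos.mpr (sub_ne_zero.mpr hαβ.symm)
  have hs0 : (0 : ℝ) < (((β - α).natAbs : ℕ) : ℝ) := by exact_mod_cast hs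
  have h1 : ∀ j, (Y - ((0 : Cell 2), α)).1 j = Y.1 j := fun j => by simp
  have h2 : (Y - ((0 : Cell 2), α)).2 = β - α := by simp [hY]
  have hj : ∀ j, max (Y.1 j).natAbs (β - α).natAbs ≤ idxNorm (Y - ((0 : Cell 2), α)) := fun j => by
    refine max_le ?_ ?_
    · have h := natAbs_fst_le_idxNorm (Y - ((0 : Cell 2), α)) j
      rwa [h1 j] at h
    · have h := natAbs_snd_le_idxNorm (Y - ((0 : Cell 2), α))
      rwa [h2] at h
  have hjR : ∀ j, max (((Y.1 j).natAbs : ℕ) : ℝ) ((((β - α).natAbs : ℕ)) : ℝ) ≤ ((idxNorm (Y - ((0 : Cell 2), α)) : ℕ) : ℝ) := fun j => by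
    rw [← Nat.cast_max]; exact_mod_cast hj j
  calc ((((idxNorm (Y - ((0 : Cell 2), α)) : ℕ) : ℝ))⁻¹) ^ 8
      = ((((idxNorm (Y - ((0 : Cell 2), α)) : ℕ) : ℝ))⁻¹) ^ 4 * ((((idxNorm (Y - ((0 : Cell 2), α)) : ℕ) : ℝ))⁻¹) ^ 4 := by ring
    _ ≤ ((max (((Y.1 0).natAbs : ℕ) : ℝ) ((((β - α).natAbs : ℕ)) : ℝ))⁻¹) ^ 4 *
          ((max (((Y.1 1).natAbs : ℕ) : ℝ) ((((β - α).natAbs : ℕ)) : ℝ))⁻¹) ^ 4 := by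
        gcongr
        · exact hjR 0
        · exact hjR 1

/-- ★ THE LAYER-SECTION SUM: over any finite family of sites in layer `β ≠ α`, `Σ_Y N(Y − (0, α))⁻⁸ ≤ 49·|β − α|⁻⁶` (embed the section into the
product of its two planar coordinate ranges; two one-dimensional tails). [this file, g58] -/
theorem sum_inv_idxNorm_pow_eight_le (α β : ℤ) (hαβ : α ≠ β) (Q : Finset (Cell 2 × ℤ)) (hQ : ∀ Y ∈ Q, Y.2 = β) :
    ∑ Y ∈ Q, ((((idxNorm (Y - ((0 : Cell 2), α)) : ℕ) : ℝ))⁻¹) ^ 8 ≤ 49 * (((((β - α).natAbs : ℕ) : ℝ))⁻¹) ^ 6 := by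
  classical
  have hs : 1 ≤ (β - α).natAbs := Int.natAbs_pos.mpr (sub_ne_zero.mpr hαβ.symm)
  set g : ℤ → ℝ := fun x => ((max ((x.natAbs : ℕ) : ℝ) ((((β - α).natAbs : ℕ)) : ℝ))⁻¹) ^ 4 with hg
  have hg0 : ∀ x, 0 ≤ g x := fun x => by rw [hg]; positivity
  have hT : ∀ R : Finset ℤ, ∑ x ∈ R, g x ≤ 7 * (((((β - α).natAbs : ℕ) : ℝ))⁻¹) ^ 3 := fun R => sum_inv_max_pow_four_le R hs
  have hT0 : ∀ R : Finset ℤ, 0 ≤ ∑ x ∈ R, g x := fun R => sum_nonneg fun x _ => hg0 x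
  have he : Set.InjOn (fun Y : Cell 2 × ℤ => (Y.1 0, Y.1 1)) Q := by
    intro Y hY Y' hY' hYY'
    simp only [Prod.mk.injEq] at hYY'
    refine Prod.ext (funext fun j => ?_) (by rw [hQ Y (mem_coe.mp hY), hQ Y' (mem_coe.mp hY')])
    exact (Fin.forall_fin_two (p := fun j => Y.1 j = Y'.1 j)).mpr hYY' j
  calc ∑ Y ∈ Q, ((((idxNorm (Y - ((0 : Cell 2), α)) : ℕ) : ℝ))⁻¹) ^ 8 ≤ ∑ Y ∈ Q, g (Y.1 0) * g (Y.1 1) :=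
        sum_le_sum fun Y hY => inv_idxNorm_pow_eight_le α β hαβ Y (hQ Y hY)
    _ ≤ ∑ p ∈ (Q.image fun Y : Cell 2 × ℤ => Y.1 0) ×ˢ (Q.image fun Y : Cell 2 × ℤ => Y.1 1), g p.1 * g p.2 :=
        sum_le_sum_of_injOn' (fun Y : Cell 2 × ℤ => (Y.1 0, Y.1 1)) he
          (fun Y hY => mem_product.mpr ⟨mem_image_of_mem _ hY, mem_image_of_mem _ hY⟩) (fun p _ => mul_nonneg (hg0 _) (hg0 _))
          fun Y _ => le_rfl
    _ = (∑ x ∈ Q.image fun Y : Cell 2 × ℤ => Y.1 0, g x) * ∑ y ∈ Q.image fun Y : Cell 2 × ℤ => Y.1 1, g y := by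
        rw [sum_product, sum_mul_sum]
    _ ≤ (7 * (((((β - α).natAbs : ℕ) : ℝ))⁻¹) ^ 3) * (7 * (((((β - α).natAbs : ℕ) : ℝ))⁻¹) ^ 3) :=
        mul_le_mul (hT _) (hT _) (hT0 _) (by positivity)
    _ = 49 * (((((β - α).natAbs : ℕ) : ℝ))⁻¹) ^ 6 := by ring

/-! ### VR.3  ★ The `ϱ`-uniform decay of the chain blocks -/

/-- ★ CHAIN BLOCK DECAY: `‖chainKL α β‖ ≤ 49·F(c)·|β − α|⁻⁶` for `α ≠ β`, uniformly in `ϱ` (UY `norm_layeredKernel_le` on each bond of the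
layer-`β` section of the near set, then `sum_inv_idxNorm_pow_eight_le`). [this file, g58] -/
theorem norm_chainKL_le_decay (hc : 0 < c) (hL : IsLayeredCrystal c a b w) (ϱ : ℝ) {α β : ℤ} (hαβ : α ≠ β) :
    ‖chainKL hc hL ϱ α β‖ ≤ 49 * kernelConst c * (((((β - α).natAbs : ℕ) : ℝ))⁻¹) ^ 6 := by
  have hF := kernelConst_nonneg hc
  refine ContinuousLinearMap.opNorm_le_bound _ (mul_nonneg (mul_nonneg (by norm_num) hF) (by positivity)) fun u => ?_
  have hN : ∀ Y : Cell 2 × ℤ, ‖lsite a b w Y.1 Y.2 - lsite a b w ((0 : Cell 2), α).1 ((0 : Cell 2), α).2‖ ≤ ϱ →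
      Y ∈ (finite_near_lsite hc hL ((0 : Cell 2), α) ϱ).toFinset :=
    fun _ hY => (finite_near_lsite hc hL ((0 : Cell 2), α) ϱ).mem_toFinset.mpr hY
  rw [chainKL_apply, chainK_eq_sum hN]
  have hQ : ∀ Y ∈ (finite_near_lsite hc hL ((0 : Cell 2), α) ϱ).toFinset.filter (fun Y => Y.2 = β), Y.2 = β :=
    fun Y hY => (mem_filter.mp hY).2
  calc ‖∑ Y ∈ (finite_near_lsite hc hL ((0 : Cell 2), α) ϱ).toFinset with Y.2 = β, nearK ϱ a b w ((0 : Cell 2), α) Y u‖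
      ≤ ∑ Y ∈ (finite_near_lsite hc hL ((0 : Cell 2), α) ϱ).toFinset with Y.2 = β, ‖nearK ϱ a b w ((0 : Cell 2), α) Y u‖ := norm_sum_le _ _
    _ ≤ ∑ Y ∈ (finite_near_lsite hc hL ((0 : Cell 2), α) ϱ).toFinset with Y.2 = β,
          kernelConst c * ((((idxNorm (Y - ((0 : Cell 2), α)) : ℕ) : ℝ))⁻¹) ^ 8 * ‖u‖ :=
        sum_le_sum fun Y _ => (norm_nearK_le ϱ a b w _ Y u).trans
          (mul_le_mul_of_nonneg_right (norm_layeredKernel_le hc hL _ Y) (norm_nonneg u))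
    _ = kernelConst c * (∑ Y ∈ (finite_near_lsite hc hL ((0 : Cell 2), α) ϱ).toFinset with Y.2 = β,
          ((((idxNorm (Y - ((0 : Cell 2), α)) : ℕ) : ℝ))⁻¹) ^ 8) * ‖u‖ := by
        rw [mul_sum, sum_mul]
    _ ≤ kernelConst c * (49 * (((((β - α).natAbs : ℕ) : ℝ))⁻¹) ^ 6) * ‖u‖ := by
        gcongr
        exact sum_inv_idxNorm_pow_eight_le α β hαβ _ hQ
    _ = 49 * kernelConst c * (((((β - α).natAbs : ℕ) : ℝ))⁻¹) ^ 6 * ‖u‖ := by ring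

/-! ### VR.4  ★ The `ϱ`-uniform decay of the flux blocks -/

/-- the cast of `toNat` of a nonnegative integer difference. [formal bookkeeping] -/
theorem cast_toNat_sub_eq {β α : ℤ} (h : α ≤ β) : ((((β - α).toNat : ℕ)) : ℝ) = (β : ℝ) - α := by
  rw [← Int.cast_natCast, Int.toNat_of_nonneg (sub_nonneg.mpr h), Int.cast_sub]

/-- the DOUBLE TAIL over a block box: for `α ≤ p ≤ q < β`, `Σ_α Σ_β (β − α)⁻⁶ ≤ 4·(q − p + 1)⁻⁴`
(inner tail `Σ_{β>q} (β−α)⁻⁶ ≤ 2(q+1−α)⁻⁵`, outer tail `Σ_{α≤p} (q+1−α)⁻⁵ ≤ 2(q−p+1)⁻⁴`, both by the inverse-square tail). [this file, g58] -/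
theorem sum_sum_inv_pow_six_le {p q : ℤ} (hpq : p ≤ q) {A B : Finset ℤ} (hA : ∀ α ∈ A, α ≤ p) (hB : ∀ β ∈ B, q + 1 ≤ β) :
    ∑ α ∈ A, ∑ β ∈ B, (((β : ℝ) - α)⁻¹) ^ 6 ≤ 4 * ((((q - p : ℤ) : ℝ) + 1)⁻¹) ^ 4 := by
  have hj0 : (0 : ℝ) < ((q - p : ℤ) : ℝ) + 1 := by
    have : (0 : ℝ) ≤ ((q - p : ℤ) : ℝ) := by exact_mod_cast sub_nonneg.mpr hpq
    linarith
  have hinner : ∀ α ∈ A, ∑ β ∈ B, (((β : ℝ) - α)⁻¹) ^ 6 ≤ 2 * (((q : ℝ) + 1 - α)⁻¹) ^ 5 := by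
    intro α hα
    have hαp := hA α hα
    have hu0 : (0 : ℝ) < (q : ℝ) + 1 - α := by
      have : (α : ℝ) ≤ q := by exact_mod_cast hαp.trans hpq
      linarith
    have hpt : ∀ β ∈ B, (((β : ℝ) - α)⁻¹) ^ 6 ≤ (((q : ℝ) + 1 - α)⁻¹) ^ 4 * (((((β - α).toNat : ℕ)) : ℝ) ^ 2)⁻¹ := by
      intro β hβ
      have hβq := hB β hβ
      have hle : (q : ℝ) + 1 - α ≤ (β : ℝ) - α := by
        have : ((q : ℝ)) + 1 ≤ β := by exact_mod_cast hβq
        linarith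
      rw [cast_toNat_sub_eq (by omega), ← inv_pow]
      calc (((β : ℝ) - α)⁻¹) ^ 6 = (((β : ℝ) - α)⁻¹) ^ 4 * (((β : ℝ) - α)⁻¹) ^ 2 := by ring
        _ ≤ (((q : ℝ) + 1 - α)⁻¹) ^ 4 * (((β : ℝ) - α)⁻¹) ^ 2 := by
            gcongr
            exact inv_nonneg.mpr (hu0.le.trans hle)
    have htail : ∑ β ∈ B, (((((β - α).toNat : ℕ)) : ℝ) ^ 2)⁻¹ ≤ 2 / ((((q - α).toNat : ℕ) : ℝ) + 1) := by
      refine sum_inv_sq_le_of_injOn (fun β : ℤ => (β - α).toNat) ?_ fun β hβ => ?_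
      · intro β hβ β' hβ' h
        have h1 := hB β (mem_coe.mp hβ)
        have h2 := hB β' (mem_coe.mp hβ')
        have h' : (β - α).toNat = (β' - α).toNat := h
        omega
      · have := hB β hβ
        omega
    have hqa : ((((q - α).toNat : ℕ) : ℝ)) + 1 = (q : ℝ) + 1 - α := by
      rw [cast_toNat_sub_eq (hαp.trans hpq)]; ring
    rw [hqa] at htail
    calc ∑ β ∈ B, (((β : ℝ) - α)⁻¹) ^ 6 ≤ ∑ β ∈ B, (((q : ℝ) + 1 - α)⁻¹) ^ 4 * (((((β - α).toNat : ℕ)) : ℝ) ^ 2)⁻¹ := sum_le_sum hpt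
      _ = (((q : ℝ) + 1 - α)⁻¹) ^ 4 * ∑ β ∈ B, (((((β - α).toNat : ℕ)) : ℝ) ^ 2)⁻¹ := by rw [mul_sum]
      _ ≤ (((q : ℝ) + 1 - α)⁻¹) ^ 4 * (2 / ((q : ℝ) + 1 - α)) := by gcongr
      _ = 2 * (((q : ℝ) + 1 - α)⁻¹) ^ 5 := by rw [div_eq_mul_inv]; ring
  have houter : ∀ α ∈ A, 2 * (((q : ℝ) + 1 - α)⁻¹) ^ 5 ≤
      2 * ((((q - p : ℤ) : ℝ) + 1)⁻¹) ^ 3 * (((((q + 1 - α).toNat : ℕ)) : ℝ) ^ 2)⁻¹ := by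
    intro α hα
    have hαp := hA α hα
    have hle : ((q - p : ℤ) : ℝ) + 1 ≤ (q : ℝ) + 1 - α := by
      have : (α : ℝ) ≤ p := by exact_mod_cast hαp
      push_cast; linarith
    have hcast : (((((q + 1 - α).toNat : ℕ)) : ℝ)) = (q : ℝ) + 1 - α := by
      rw [← Int.cast_natCast, Int.toNat_of_nonneg (by omega)]; push_cast; ring
    rw [hcast, ← inv_pow]
    calc 2 * (((q : ℝ) + 1 - α)⁻¹) ^ 5 = 2 * (((q : ℝ) + 1 - α)⁻¹) ^ 3 * (((q : ℝ) + 1 - α)⁻¹) ^ 2 := by ring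
      _ ≤ 2 * ((((q - p : ℤ) : ℝ) + 1)⁻¹) ^ 3 * (((q : ℝ) + 1 - α)⁻¹) ^ 2 := by
          gcongr
          exact inv_nonneg.mpr (hj0.le.trans hle)
  have htail : ∑ α ∈ A, (((((q + 1 - α).toNat : ℕ)) : ℝ) ^ 2)⁻¹ ≤ 2 / ((((q - p).toNat : ℕ) : ℝ) + 1) := by
    refine sum_inv_sq_le_of_injOn (fun α : ℤ => (q + 1 - α).toNat) ?_ fun α hα => ?_
    · intro α hα α' hα' h
      have h1 := hA α (mem_coe.mp hα)
      have h2 := hA α' (mem_coe.mp hα')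
      have h' : (q + 1 - α).toNat = (q + 1 - α').toNat := h
      omega
    · have := hA α hα
      omega
  have hqp : ((((q - p).toNat : ℕ) : ℝ)) + 1 = ((q - p : ℤ) : ℝ) + 1 := by
    rw [cast_toNat_sub_eq hpq]; push_cast; ring
  rw [hqp] at htail
  calc ∑ α ∈ A, ∑ β ∈ B, (((β : ℝ) - α)⁻¹) ^ 6 ≤ ∑ α ∈ A, 2 * (((q : ℝ) + 1 - α)⁻¹) ^ 5 := sum_le_sum hinner
    _ ≤ ∑ α ∈ A, 2 * ((((q - p : ℤ) : ℝ) + 1)⁻¹) ^ 3 * (((((q + 1 - α).toNat : ℕ)) : ℝ) ^ 2)⁻¹ := sum_le_sum houter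
    _ = 2 * ((((q - p : ℤ) : ℝ) + 1)⁻¹) ^ 3 * ∑ α ∈ A, (((((q + 1 - α).toNat : ℕ)) : ℝ) ^ 2)⁻¹ := by rw [mul_sum]
    _ ≤ 2 * ((((q - p : ℤ) : ℝ) + 1)⁻¹) ^ 3 * (2 / (((q - p : ℤ) : ℝ) + 1)) := by gcongr
    _ = 4 * ((((q - p : ℤ) : ℝ) + 1)⁻¹) ^ 4 := by rw [div_eq_mul_inv]; ring

/-- ★★ FLUX BLOCK DECAY: `‖fluxBlock m k‖ ≤ 196·F(c)·(1 + |m − k|)⁻⁴`, uniformly in `ϱ` (the block box is `α ≤ min m k < max m k + 1 ≤ β`, so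
`β − α ≥ |m − k| + 1`; `norm_chainKL_le_decay` + `sum_sum_inv_pow_six_le`). [this file, g58] -/
theorem norm_fluxBlock_le_decay (hc : 0 < c) (hL : IsLayeredCrystal c a b w) (ϱ : ℝ) (m k : ℤ) :
    ‖fluxBlock hc hL ϱ m k‖ ≤ 196 * kernelConst c * (((((m - k).natAbs : ℕ) : ℝ) + 1)⁻¹) ^ 4 := by
  have hF := kernelConst_nonneg hc
  have hA : ∀ α ∈ Icc (m - ⌊ϱ / c⌋₊) (min m k), α ≤ min m k := fun α hα => (mem_Icc.mp hα).2
  have hB : ∀ β ∈ Icc (max m k + 1) (m + 1 + ⌊ϱ / c⌋₊), max m k + 1 ≤ β := fun β hβ => (mem_Icc.mp hβ).1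
  have hj : ((max m k - min m k : ℤ) : ℝ) + 1 = ((((m - k).natAbs : ℕ) : ℝ)) + 1 := by
    have h : (max m k - min m k : ℤ) = (((m - k).natAbs : ℕ) : ℤ) := by omega
    rw [← Int.cast_natCast (R := ℝ), ← h]
  have hterm : ∀ α ∈ Icc (m - ⌊ϱ / c⌋₊) (min m k), ∀ β ∈ Icc (max m k + 1) (m + 1 + ⌊ϱ / c⌋₊),
      ‖chainKL hc hL ϱ α β‖ ≤ 49 * kernelConst c * (((β : ℝ) - α)⁻¹) ^ 6 := by
    intro α hα β hβ
    have hlt : α < β := by have := hA α hα; have := hB β hβ; omega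
    have hcast : (((((β - α).natAbs : ℕ)) : ℝ)) = (β : ℝ) - α := by
      rw [← Int.cast_natCast, Int.natAbs_of_nonneg (by omega), Int.cast_sub]
    have h := norm_chainKL_le_decay hc hL ϱ hlt.ne
    rwa [hcast] at h
  calc ‖fluxBlock hc hL ϱ m k‖ ≤ ∑ α ∈ Icc (m - ⌊ϱ / c⌋₊) (min m k), ‖∑ β ∈ Icc (max m k + 1) (m + 1 + ⌊ϱ / c⌋₊), chainKL hc hL ϱ α β‖ :=
        norm_sum_le _ _
    _ ≤ ∑ α ∈ Icc (m - ⌊ϱ / c⌋₊) (min m k), ∑ β ∈ Icc (max m k + 1) (m + 1 + ⌊ϱ / c⌋₊), ‖chainKL hc hL ϱ α β‖ :=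
        sum_le_sum fun α _ => norm_sum_le _ _
    _ ≤ ∑ α ∈ Icc (m - ⌊ϱ / c⌋₊) (min m k), ∑ β ∈ Icc (max m k + 1) (m + 1 + ⌊ϱ / c⌋₊), 49 * kernelConst c * (((β : ℝ) - α)⁻¹) ^ 6 :=
        sum_le_sum fun α hα => sum_le_sum fun β hβ => hterm α hα β hβ
    _ = 49 * kernelConst c * ∑ α ∈ Icc (m - ⌊ϱ / c⌋₊) (min m k), ∑ β ∈ Icc (max m k + 1) (m + 1 + ⌊ϱ / c⌋₊), (((β : ℝ) - α)⁻¹) ^ 6 := by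
        rw [mul_sum]; refine sum_congr rfl fun α _ => ?_; rw [mul_sum]
    _ ≤ 49 * kernelConst c * (4 * ((((max m k - min m k : ℤ) : ℝ)) + 1)⁻¹ ^ 4) :=
        mul_le_mul_of_nonneg_left (sum_sum_inv_pow_six_le min_le_max hA hB) (mul_nonneg (by norm_num) hF)
    _ = 196 * kernelConst c * (((((m - k).natAbs : ℕ) : ℝ) + 1)⁻¹) ^ 4 := by rw [hj]; ring

end FluxDecay

end Summit.AtomisticToContinuum.Crystallization.Theorems.ChartedZeroExcessLayeredLatticeLiouville
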